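import Literature.NumberTheory.Transcendental.ManyCurveStdReduction
import HarnessLib

/-!
# Crux `RealOnePeriodRelations` (stmt-KontsevichZagierPeriods-10042),
# line `nash-retraction-thin-strip`, stub `stub_famAlternatives`:
# the alternatives at GENERAL algebraic points of `G = 𝔾ₐ × 𝔾ₘ^ι × ∏_b E_{cls b}♮`

The multi-curve open-path layer of the line needs the ANALYTIC-SUBGROUP ALTERNATIVES at general
algebraic points of `G = 𝔾ₐ × 𝔾ₘ^ι × ∏_b E_{cls b}♮` (pairwise non-isogenous lattices `L i` with
algebraic invariants, CM classes with at most one block): if `exp_G(u)` is algebraic and the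
coordinates of `u = (x; y; z; t)` are `ℚ̄`-linearly dependent, then `x = 0`, or the `yᵢ` satisfy
a non-trivial integer relation, or the `z`-coordinates of ONE class do. The transcendence input
is Baker–Wüstholz's Thm. 6.15 in HYPERPLANE form for ALL family standard models
`M = 𝔾ₘ^β × P` (`Literature/NumberTheory/Transcendental/ManyCurveStd.lean`) at ALL algebraic
points (`GaGmEFam.Std.Alg`, not `AlgTors`), the explicit hypothesis `hstdH`.

The tree proves exactly this implication at points with TORSION abelian part
(`ManyCurveStdReduction.lean`: `GaGmEFam.Std.hyperplaneTheorem_presTors_of_std_torsHyperplane`,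
`periods_alternatives_of_hyperplaneTheorem`, `HuberWustholzManyCurvePeriods_of_std_torsHyperplane`).
This file is the same chain with `Alg` in place of `AlgTors`:

* `GaGmEFam.Std.QuotData.Φ_mem_Alg` — the adapted coordinates `Φ : Lie M → Lie(M/K₀)` of
  `QuotData` (`ManyCurveStdQuot.lean`) map `Alg(M)` into `Alg(M/K₀)` (the `Alg` half of the
  landed `Φ_mem_AlgTors`: the new `z`-coordinates of class `i` are integer combinations of old
  `z`-coordinates of class `i` only, `PeriodPair.IsUnivExtAlgPoint.sum_int_mul`);
* `hyperplaneTheorem_presAlg_of_stdH` — the hyperplane theorem for the QUOTIENTS `M/K₀` of every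
  family standard model, for the UNRESTRICTED Lie presentation (`Alg := GaGmEFam.Std.Alg`, the
  other seven fields those of `GaGmEFam.Std.presTors`), from `hstdH` (transport verbatim from
  `hyperplaneTheorem_presTors_of_std_torsHyperplane`, Baker–Wüstholz 2007, §6.8, p. 115);
* `stub_famAlternatives` — at a general algebraic point `u = (y; z; (x; t))` of the model
  `𝔾ₘ^ι × P₀`, `P₀ = 𝔾ₐ × ∏_b E_{cls b}♮` (push-out matrix `κM₀ B`): `u ∈ Alg`, minimality
  `SubgroupData.tangent_eq_top_of_mem₀`, the dévissage
  `LiePresentation.linearIndependent_of_hyperplaneTheorem`, and the reindexing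
  `lieCoords_eq_coords_comp` / `qbarLinearIndependent_comp_equiv`.

References: A. Baker, G. Wüstholz, *Logarithmic Forms and Diophantine Geometry*, New Math.
Monogr. 9, CUP 2007, Thm. 6.1, Thm. 6.15, §6.7, §6.8 (p. 115). [BakerWustholz2007]
A. Huber, G. Wüstholz, *Transcendence and Linear Relations of 1-Periods*, Cambridge Tracts 227,
CUP 2022, Thm. 6.2. [HuberWustholz2022]
-/

noncomputable section

open Complex Module Submodule

/-! ### `Φ` maps `Alg(M)` into `Alg(M/K₀)` -/

namespace Literature.NumberTheory.Transcendental.GaGmEFam.Std.QuotData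

open GaGmE (Kbar)
open GaGmE.Std (iy iz is coords coords_iy coords_iz coords_is)

variable {J : Type} [Fintype J] [DecidableEq J] {β γ δ : Type} [Fintype β] [Fintype γ]
  [Fintype δ] {cls : γ → J} {κM : δ → γ → Kbar} {D₀ : SubgroupData β γ δ cls κM}
  (Q : QuotData D₀)

/-- **`Φ : Lie M → Lie(M/K₀)` maps `Alg(M)` into `Alg(M/K₀)`** (the `Alg` half of the landed
`QuotData.Φ_mem_AlgTors`, family version of `GaGmE.Std.QuotData.Φ_mem_Alg`): the new
`𝔾ₘ`-coordinates are integer combinations of the old ones, the new `z`-coordinates of class `i`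
are integer combinations of old `z`-coordinates of class `i` only (so integer combinations of
`ℚ̄`-points of ONE `Eᵢ♮`, `PeriodPair.IsUnivExtAlgPoint.sum_int_mul`), and the new fibre sections
differ from `κ'` of the new representative by `ℚ̄`-combinations of the old differences
(`κM'_spec`). [cite: BakerWustholz2007, §6.8 (Thm. 6.1 from Thm. 6.15; p. 115)] -/
theorem Φ_mem_Alg {L : J → PeriodPair}
    (hL : ∀ i, IsAlgebraic ℚ (L i).g₂ ∧ IsAlgebraic ℚ (L i).g₃)
    {w : β ⊕ (γ ⊕ δ) → ℂ} (hw : w ∈ Alg L cls κM) : Q.Φ w ∈ Alg L Q.cls' Q.κM' := by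
  classical
  obtain ⟨hy, t, hzt, hs⟩ := hw
  refine ⟨fun j => ?_, fun b => ∑ k, (Q.cvv b k : ℂ) * t k, fun b => ?_, fun e => ?_⟩
  · rw [Φ_iy, Complex.exp_sum]
    refine Finset.prod_induction _ (fun x => IsAlgebraic ℚ x) (fun a b ha hb => ha.mul hb)
      isAlgebraic_one fun i _ => ?_
    rw [Complex.exp_int_mul]
    exact isAlgebraic_zpow (hy i) _
  · rw [Φ_iz]
    dsimp only
    rw [Q.sum_cvv_eq_sum_filter, Q.sum_cvv_eq_sum_filter]
    refine PeriodPair.IsUnivExtAlgPoint.sum_int_mul (hL b.1).1 (hL b.1).2 _ _ _ _ fun k hk => ?_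
    have hk' : cls k = b.1 := (Finset.mem_filter.mp hk).2
    show (L b.1).IsUnivExtAlgPoint (w (iz k)) (t k)
    rw [← hk']
    exact hzt k
  · rw [Φ_is]
    have hκ : ∀ k, (∑ e', (Q.ξv e e' : ℂ) * (κM e' k : ℂ)) =
        ∑ b, (Q.κM' e b : ℂ) * (Q.cvv b k : ℂ) := by
      intro k
      have := congrArg (algebraMap Kbar ℂ) (Q.κM'_spec e k)
      simpa [map_sum, map_mul, cvv] using this
    have e1 : ∑ e', (Q.ξv e e' : ℂ) * w (is e') -
        ∑ b, (Q.κM' e b : ℂ) * ∑ k, (Q.cvv b k : ℂ) * t k =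
        ∑ e', (Q.ξv e e' : ℂ) * (w (is e') - ∑ k, (κM e' k : ℂ) * t k) := by
      have e2 : ∑ b, (Q.κM' e b : ℂ) * ∑ k, (Q.cvv b k : ℂ) * t k =
          ∑ k, (∑ b, (Q.κM' e b : ℂ) * (Q.cvv b k : ℂ)) * t k := by
        simp only [Finset.mul_sum, Finset.sum_mul]
        rw [Finset.sum_comm]
        exact Finset.sum_congr rfl fun k _ => Finset.sum_congr rfl fun b _ => by ring
      have e3 : ∑ e', (Q.ξv e e' : ℂ) * (w (is e') - ∑ k, (κM e' k : ℂ) * t k) =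
          ∑ e', (Q.ξv e e' : ℂ) * w (is e') -
            ∑ k, (∑ e', (Q.ξv e e' : ℂ) * (κM e' k : ℂ)) * t k := by
        simp only [mul_sub, Finset.sum_sub_distrib, Finset.mul_sum, Finset.sum_mul]
        congr 1
        rw [Finset.sum_comm]
        exact Finset.sum_congr rfl fun k _ => Finset.sum_congr rfl fun e' _ => by ring
      rw [e2, e3]
      simp only [hκ]
    rw [e1]
    refine Finset.sum_induction _ (fun x => IsAlgebraic ℚ x) (fun a b ha hb => ha.add hb)
      isAlgebraic_zero fun e' _ => ?_
    exact (mem_algebraicClosure_iff.mp (Q.ξv e e').2).mul (hs e')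

end Literature.NumberTheory.Transcendental.GaGmEFam.Std.QuotData

open Literature.NumberTheory.Transcendental

namespace Summit.KontsevichZagierPeriods.SymplecticScissors.RealOnePeriodRelations.MultiEllLayer

open GaGmEFam GaGmEFam.Std
open GaGmE.Std (coords coords_iy coords_iz coords_is)

/-! ### The hyperplane theorem for the quotients `M/K₀`, unrestricted algebraic points -/

/-- **Transport (hyperplane form, ALL algebraic points).** The hyperplane statement for ALL
family standard models at all algebraic points (the explicit hypothesis `hstdH`: Baker–Wüstholz
2007, Thm. 6.15 for `M = 𝔾ₘ^β × P`, `ℚ̄`-rational hyperplanes `W` without non-zero algebraic Lie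
subalgebras, algebraic points of `exp(W_ℂ)`) implies the hyperplane theorem for the QUOTIENTS
`M/K₀` of each of them, i.e. `LiePresentation.HyperplaneTheorem` for the UNRESTRICTED Lie
presentation of `M` (kernel `ker(exp_M)`, `Alg := GaGmEFam.Std.Alg`, the algebraic Lie
subalgebras `GaGmEFam.Std.algLie`; torsion points are algebraic by
`GaGmEFam.Std.torsion_mem_Alg`, discreteness by `SubgroupData.mem_tangent_of_forall_exists`): in
the adapted coordinates `Φ : Lie M → Lie(M/K₀)` of `QuotData` a `ℚ̄`-rational hyperplane
`W ⊇ Lie K₀` maps onto a `ℚ̄`-rational hyperplane, algebraic `K' ⊆ M/K₀` inside `Φ(W)` pull back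
to algebraic `K` between `K₀` and `W`, algebraic points map to algebraic points
(`QuotData.Φ_mem_Alg`), CM classes keep at most one block (`QuotData.cls'_eq_imp`), and the kernel
lifts (`QuotData.exists_ker_of_Φ_mem_ker`) — the proof of
`GaGmEFam.Std.hyperplaneTheorem_presTors_of_std_torsHyperplane` verbatim.
[cite: BakerWustholz2007, §6.8 (Thm. 6.1 from Thm. 6.15; p. 115)] -/
theorem hyperplaneTheorem_presAlg_of_stdH
    (hstdH : ∀ (J : Type) [Fintype J] [DecidableEq J] (L : J → PeriodPair),
      (∀ i, IsAlgebraic ℚ (L i).g₂ ∧ IsAlgebraic ℚ (L i).g₃) →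
      (∀ i j, i ≠ j → ¬ (L i).IsIsogenousTo (L j)) →
      ∀ (β γ δ : Type) [Fintype β] [Fintype γ] [Fintype δ] (cls : γ → J),
        (∀ b b', cls b = cls b' → (L (cls b)).HasCM → b = b') →
        ∀ (κM : δ → γ → GaGmE.Kbar) (W : Submodule ℂ (β ⊕ (γ ⊕ δ) → ℂ)),
        LiePresentation.IsKRational GaGmE.Kbar W → Module.finrank ℂ W + 1 = Fintype.card (β ⊕ (γ ⊕ δ)) →
        (∀ 𝔨 ∈ GaGmEFam.Std.algLie cls κM, 𝔨 ≤ W → 𝔨 = ⊥) →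
        ∀ w ∈ W, w ∈ GaGmEFam.Std.Alg L cls κM → w ∈ GaGmEFam.Std.ker L cls κM)
    (J : Type) [Fintype J] [DecidableEq J] (L : J → PeriodPair)
    (hL : ∀ i, IsAlgebraic ℚ (L i).g₂ ∧ IsAlgebraic ℚ (L i).g₃)
    (hiso : ∀ i j, i ≠ j → ¬ (L i).IsIsogenousTo (L j))
    (β γ δ : Type) [Fintype β] [Fintype γ] [Fintype δ] (cls : γ → J)
    (hcm1 : ∀ b b', cls b = cls b' → (L (cls b)).HasCM → b = b')
    (κM : δ → γ → GaGmE.Kbar) :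
    ({ GaGmEFam.Std.presTors (β := β) L cls κM hL with
        Alg := GaGmEFam.Std.Alg L cls κM
        torsion_mem := fun _ hk _ hm => GaGmEFam.Std.torsion_mem_Alg hL hk hm } :
      LiePresentation GaGmE.Kbar ℂ (β ⊕ (γ ⊕ δ))).HyperplaneTheorem := by
  refine ⟨?_⟩
  rintro _ ⟨D₀, rfl⟩ W hWrat h𝔥W hWdim hmax w hwW hwAlg
  classical
  obtain ⟨Q⟩ := nonempty_quotData D₀
  set W' : Submodule ℂ (Q.σ' → ℂ) := W.map Q.Φ with hW'
  have hcomapW : W'.comap Q.Φ = W := by rw [hW', Q.comap_map, sup_eq_left.mpr h𝔥W]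
  -- (T1) rationality
  have h1 : LiePresentation.IsKRational GaGmE.Kbar W' := Q.isKRational_map hWrat
  -- (T2) `Φ(W)` is a hyperplane
  set h : ℕ := finrank ℂ ↥D₀.tangent
  have hdimW : finrank ℂ W = finrank ℂ W' + h := by rw [← hcomapW]; exact Q.finrank_comap W'
  have hcard : Fintype.card (β ⊕ (γ ⊕ δ)) = Fintype.card Q.σ' + h := Q.card_eq
  have h2 : finrank ℂ W' + 1 = Fintype.card Q.σ' := by
    change finrank ℂ ↥W + 1 = Fintype.card (β ⊕ (γ ⊕ δ)) at hWdim
    omega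
  -- (T3) no non-zero algebraic Lie subalgebra inside `Φ(W)`
  have h3 : ∀ 𝔨' ∈ algLie Q.cls' Q.κM', 𝔨' ≤ W' → 𝔨' = ⊥ := by
    rintro _ ⟨D', rfl⟩ hle
    have hpullW : (Q.pull D').tangent ≤ W := by
      rw [← Q.comap_tangent, ← hcomapW]
      exact Submodule.comap_mono hle
    have heq : (Q.pull D').tangent = D₀.tangent :=
      hmax (Q.pull D').tangent ⟨Q.pull D', rfl⟩ (Q.tangent_le_pull D') hpullW
    apply Submodule.comap_injective_of_surjective Q.Φ_surjective
    rw [Q.comap_tangent, heq, Submodule.comap_bot, Q.ker_Φ]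
  -- (T4) algebraic points, and the hyperplane statement for `M/K₀`
  have h4 : Q.Φ w ∈ Alg L Q.cls' Q.κM' := Q.Φ_mem_Alg hL hwAlg
  have h5 := hstdH J L hL hiso _ _ _ Q.cls' (Q.cls'_eq_imp hcm1) Q.κM' W' h1 h2 h3 (Q.Φ w)
    (Submodule.mem_map_of_mem hwW) h4
  -- (T5) lift the kernel
  obtain ⟨k, hk, hwk⟩ := Q.exists_ker_of_Φ_mem_ker h5
  exact ⟨k, hk, w - k, hwk, by abel⟩

/-! ### The alternatives at general algebraic points -/

/-- **The alternatives at general algebraic points of `G = 𝔾ₐ × 𝔾ₘ^ι × ∏_b E_{cls b}♮` from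
the hyperplane statement for the family standard models at all algebraic points.** If
`exp_G(u)` is algebraic (`hx`, `hy`, `hzt`) and the coordinates of `u = (x; y; z; t)` are
`ℚ̄`-linearly dependent, then `x = 0`, or the `yᵢ` satisfy a non-trivial integer relation, or the
`z`-coordinates of ONE class do. Proof (the chain of
`GaGmEFam.Std.periods_alternatives_of_hyperplaneTheorem` /
`HuberWustholzManyCurvePeriods_of_std_torsHyperplane` with `Alg` for `AlgTors`): in the model
`𝔾ₘ^ι × P₀`, `P₀ = 𝔾ₐ × ∏_b E_{cls b}♮` (push-out matrix `κM₀ B`), with its UNRESTRICTED Lie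
presentation, `u' = (y; z; (x; t))` is an algebraic point; were none of the alternatives to hold,
no proper connected algebraic subgroup would contain `u'` in its Lie algebra
(`SubgroupData.tangent_eq_top_of_mem₀`), so the dévissage
`LiePresentation.linearIndependent_of_hyperplaneTheorem` fed with
`hyperplaneTheorem_presAlg_of_stdH` would make the coordinates of `u'` — those of `u` reindexed
(`lieCoords_eq_coords_comp`, `qbarLinearIndependent_comp_equiv`) — `ℚ̄`-linearly independent.
[cite: BakerWustholz2007, §6.8 (Thm. 6.1 from Thm. 6.15; p. 115)] -/
theorem stub_famAlternatives
    (hstdH : ∀ (J : Type) [Fintype J] [DecidableEq J] (L : J → PeriodPair),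
      (∀ i, IsAlgebraic ℚ (L i).g₂ ∧ IsAlgebraic ℚ (L i).g₃) →
      (∀ i j, i ≠ j → ¬ (L i).IsIsogenousTo (L j)) →
      ∀ (β γ δ : Type) [Fintype β] [Fintype γ] [Fintype δ] (cls : γ → J),
        (∀ b b', cls b = cls b' → (L (cls b)).HasCM → b = b') →
        ∀ (κM : δ → γ → GaGmE.Kbar) (W : Submodule ℂ (β ⊕ (γ ⊕ δ) → ℂ)),
        LiePresentation.IsKRational GaGmE.Kbar W → Module.finrank ℂ W + 1 = Fintype.card (β ⊕ (γ ⊕ δ)) →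
        (∀ 𝔨 ∈ GaGmEFam.Std.algLie cls κM, 𝔨 ≤ W → 𝔨 = ⊥) →
        ∀ w ∈ W, w ∈ GaGmEFam.Std.Alg L cls κM → w ∈ GaGmEFam.Std.ker L cls κM)
    {J : Type} [Fintype J] [DecidableEq J] (L : J → PeriodPair)
    (hL : ∀ i, IsAlgebraic ℚ (L i).g₂ ∧ IsAlgebraic ℚ (L i).g₃)
    (hiso : ∀ i j, i ≠ j → ¬ (L i).IsIsogenousTo (L j))
    (ι B : Type) [Fintype ι] [Fintype B] (cls : B → J)
    (hcm1 : ∀ b b', cls b = cls b' → (L (cls b)).HasCM → b = b')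
    (x : ℂ) (y : ι → ℂ) (z t : B → ℂ) (hx : IsAlgebraic ℚ x) (hy : ∀ i, IsAlgebraic ℚ (cexp (y i)))
    (hzt : ∀ b, (L (cls b)).IsUnivExtAlgPoint (z b) (t b))
    (hdep : ¬ QbarLinearIndependent (lieCoords x y z t)) :
    x = 0 ∨ (∃ p : ι → ℤ, p ≠ 0 ∧ ∑ i, (p i : ℂ) * y i = 0) ∨
      ∃ (i : J) (a : B → ℤ), a ≠ 0 ∧ (∀ b, cls b ≠ i → a b = 0) ∧ ∑ b, (a b : ℂ) * z b = 0 := by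
  classical
  by_contra hcon
  simp only [not_or, not_exists, not_and] at hcon
  obtain ⟨hx0, hny, hnz⟩ := hcon
  -- the unrestricted Lie presentation of the model `𝔾ₘ^ι × P₀`
  set P : LiePresentation GaGmE.Kbar ℂ (ι ⊕ (B ⊕ (Unit ⊕ B))) :=
    { GaGmEFam.Std.presTors (β := ι) L cls (κM₀ B) hL with
        Alg := GaGmEFam.Std.Alg L cls (κM₀ B)
        torsion_mem := fun _ hk _ hm => GaGmEFam.Std.torsion_mem_Alg hL hk hm } with hP
  -- the hyperplane theorem for its quotients
  have hH : P.HyperplaneTheorem :=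
    hyperplaneTheorem_presAlg_of_stdH hstdH J L hL hiso ι B (Unit ⊕ B) cls hcm1 (κM₀ B)
  -- `u' = (y; z; (x; t))` is an algebraic point of the model
  have hu : coords y z (Sum.elim (fun _ : Unit => x) t) ∈ P.Alg := by
    refine ⟨fun j => ?_, t, fun b => ?_, fun e => ?_⟩
    · simpa only [coords_iy] using hy j
    · simpa only [coords_iz] using hzt b
    · simp only [coords_is]
      rw [sum_κM₀_mul]
      rcases e with u | k
      · simp only [Sum.elim_inl, sub_zero]; exact hx
      · simp only [Sum.elim_inr, sub_self]; exact isAlgebraic_zero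
  -- minimality of the model for `u'`
  have hmin : ∀ 𝔥 ∈ P.algLie, coords y z (Sum.elim (fun _ : Unit => x) t) ∈ 𝔥 → 𝔥 = ⊤ := by
    rintro _ ⟨D, rfl⟩ huD
    exact D.tangent_eq_top_of_mem₀ hx0 hny (fun i a ha hsupp => hnz i a ha hsupp) huD
  -- the dévissage, and the reindexing `lieCoords x y z t = u' ∘ lieCoordsEquiv ι B`
  have key := P.linearIndependent_of_hyperplaneTheorem hH hu hmin
  apply hdep
  rw [lieCoords_eq_coords_comp]
  exact qbarLinearIndependent_comp_equiv _ (GaGmEE.qbarLinearIndependent_of_pair_eq_zero key)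

end Summit.KontsevichZagierPeriods.SymplecticScissors.RealOnePeriodRelations.MultiEllLayer

end
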